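import Summits.Ventures.HodgeRepro2.T5SU11WeightedSpaceGroundStateODE
import Summits.Ventures.HodgeRepro2.T5SU11KernelCompositionSign

/-!
# The composed kernels alternate STRICTLY in sign: `(−1)^{n+1} K_λ^{∘(n+1)}(t, s) > 0`

Row 563's strong maximum principle on `W_1` (`g ≥ 0`, `g(t₀) > 0` ⇒ `G^I_λ g < 0` everywhere on `(0, ∞)`), iterated: the
signed iterate `(−1)^{n+1} (G^I_λ)^{n+1} g` is positive everywhere, for every `g ∈ W_1` that is non-negative and positive
somewhere; the kernel source `K_λ(·, s) < 0` (row 4xx) is such a source up to sign.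

* `iterate_sign_pos_ground` — **`(−1)^{n+1} (G^I_λ)^{n+1} g(t) > 0`** for `g ∈ W_1`, `g ≥ 0` on `(0, ∞)`, `g(t₀) > 0`;
* `kernel_comp_sign_pos` — **`(−1)^{n+1} K_λ^{∘(n+1)}(t, s) > 0`** for every `λ > 1`, `n`, `t, s > 0`;
* `kernel_comp_ne_zero` — the composed kernels never vanish on `(0, ∞)²`.

Nothing is claimed about (N).

Blind lane: Mathlib + the HodgeRepro2 prefix only; no sorry; axioms ⊆ {propext, Classical.choice,
Quot.sound}.
-/

namespace Summit.Ventures.HodgeRepro2.T5SU11KernelCompositionStrictSign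

open Filter Topology MeasureTheory
open Set (Ioi Ioc)
open T5SU11Cartan T5SU11SphericalFunction T5SU11SphericalDecay T5SU11RadialGreenKernel T5SU11RadialGreenImproper
  T5SU11RadialGreenPositivity T5SU11KernelDifferenceRegularity T5SU11KernelDerivative T5SU11WeightedSpaceGroundState
  T5SU11WeightedSpaceGroundStateODE T5SU11KernelCompositionDerivative

section measure

variable [MeasurableSpace Circle] [BorelSpace Circle]

variable {lam : ℝ} (hlam : 1 < lam)

include hlam in
/-- **The signed iterates of a non-negative, somewhere positive `W_1` source are positive everywhere**:
`(−1)^{n+1} (G^I_λ)^{n+1} g(t) > 0` for every `n` and `t > 0` (the strong maximum principle of row 563, iterated). -/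
theorem iterate_sign_pos_ground {g : ℝ → ℝ} (hg : ContinuousOn g (Ioi 0)) {D : ℝ}
    (hD : ∀ s, 0 < s → |g s| ≤ D * sph 1 (hyp s)) (hg0 : ∀ s, 0 < s → 0 ≤ g s) {t₀ : ℝ} (ht₀ : 0 < t₀)
    (hgt₀ : 0 < g t₀) (n : ℕ) {t : ℝ} (ht : 0 < t) :
    0 < (-1 : ℝ) ^ (n + 1) * ((greenSolI (fun t => sph lam (hyp t)) (sphDecay lam))^[n + 1] g) t := by
  induction n generalizing t with
  | zero =>
    have h := greenSolI_neg_ground hlam hg hD hg0 ht₀ hgt₀ ht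
    simp only [zero_add, pow_one, Function.iterate_one]
    linarith
  | succ n ih =>
    -- the signed iterate `ĥ = (−1)^{n+1} (G^I_λ)^{n+1} g ∈ W_1` is non-negative and positive at `1`
    obtain ⟨hc, hb⟩ := iterate_mem_weighted_one hlam hg hD (n + 1)
    have hcont : ContinuousOn (fun r => (-1 : ℝ) ^ (n + 1)
        * ((greenSolI (fun t => sph lam (hyp t)) (sphDecay lam))^[n + 1] g) r) (Ioi 0) :=
      continuousOn_const.mul hc
    have hbound : ∀ r, 0 < r → |(-1 : ℝ) ^ (n + 1)
        * ((greenSolI (fun t => sph lam (hyp t)) (sphDecay lam))^[n + 1] g) r|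
        ≤ D / ((lam - 1) ^ 2) ^ (n + 1) * sph 1 (hyp r) := by
      intro r hr
      rw [abs_mul, abs_pow, abs_neg, abs_one, one_pow, one_mul, div_mul_eq_mul_div]
      exact hb r hr
    have hnonneg : ∀ r, 0 < r → 0 ≤ (-1 : ℝ) ^ (n + 1)
        * ((greenSolI (fun t => sph lam (hyp t)) (sphDecay lam))^[n + 1] g) r :=
      fun r hr => (ih hr).le
    have hpos1 : 0 < (-1 : ℝ) ^ (n + 1)
        * ((greenSolI (fun t => sph lam (hyp t)) (sphDecay lam))^[n + 1] g) 1 := ih one_pos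
    -- the strong maximum principle on `ĥ`, and `G^I_λ ĥ = (−1)^{n+1} G^I_λ h`
    have h := greenSolI_neg_ground hlam hcont hbound hnonneg one_pos hpos1 ht
    have e := iterate_const_mul (fun t => sph lam (hyp t)) (sphDecay lam)
      ((greenSolI (fun t => sph lam (hyp t)) (sphDecay lam))^[n + 1] g) ((-1 : ℝ) ^ (n + 1)) 1
    rw [Function.iterate_one] at e
    rw [e] at h
    simp only at h
    rw [Function.iterate_succ_apply', pow_succ]
    have e2 : (-1 : ℝ) ^ (n + 1) * (-1) * greenSolI (fun t => sph lam (hyp t)) (sphDecay lam)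
          ((greenSolI (fun t => sph lam (hyp t)) (sphDecay lam))^[n + 1] g) t
        = -((-1 : ℝ) ^ (n + 1) * greenSolI (fun t => sph lam (hyp t)) (sphDecay lam)
          ((greenSolI (fun t => sph lam (hyp t)) (sphDecay lam))^[n + 1] g) t) := by ring
    rw [e2]
    linarith

include hlam in
/-- **THE COMPOSED KERNELS ALTERNATE STRICTLY IN SIGN**: `(−1)^{n+1} (G^I_λ)ⁿ K_λ(·, s)(t) > 0` for every `λ > 1`, `n` and
`t, s > 0`. -/
theorem kernel_comp_sign_pos {s : ℝ} (hs : 0 < s) (n : ℕ) {t : ℝ} (ht : 0 < t) :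
    0 < (-1 : ℝ) ^ (n + 1)
      * ((greenSolI (fun t => sph lam (hyp t)) (sphDecay lam))^[n] (fun r => sphGreenKernel lam r s)) t := by
  cases n with
  | zero =>
    have h := sphGreenKernel_neg hlam (s := s) ht
    simp only [zero_add, pow_one, Function.iterate_zero, id_eq]
    linarith
  | succ n =>
    -- the source `−K_λ(·, s) ∈ W_1` is positive everywhere
    obtain ⟨D, _, hD⟩ := kernel_source_mem_weighted_one hlam hs
    have hg := kernel_source_continuousOn hlam hs
    have hcont : ContinuousOn (fun r => (-1 : ℝ) * sphGreenKernel lam r s) (Ioi 0) := continuousOn_const.mul hg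
    have hbound : ∀ r, 0 < r → |(-1 : ℝ) * sphGreenKernel lam r s| ≤ D * sph 1 (hyp r) := by
      intro r hr
      rw [abs_mul, abs_neg, abs_one, one_mul]
      exact hD r hr
    have hnonneg : ∀ r, 0 < r → 0 ≤ (-1 : ℝ) * sphGreenKernel lam r s := by
      intro r hr
      have := sphGreenKernel_neg hlam (s := s) hr
      linarith
    have hpos1 : 0 < (-1 : ℝ) * sphGreenKernel lam 1 s := by
      have := sphGreenKernel_neg hlam (s := s) one_pos
      linarith
    have h := iterate_sign_pos_ground hlam hcont hbound hnonneg one_pos hpos1 n ht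
    rw [iterate_const_mul] at h
    simp only at h
    have e : (-1 : ℝ) ^ (n + 1 + 1)
        * ((greenSolI (fun t => sph lam (hyp t)) (sphDecay lam))^[n + 1] (fun r => sphGreenKernel lam r s)) t
        = (-1 : ℝ) ^ (n + 1)
          * ((-1) * ((greenSolI (fun t => sph lam (hyp t)) (sphDecay lam))^[n + 1]
            (fun r => sphGreenKernel lam r s)) t) := by
      rw [pow_succ]
      ring
    rw [e]
    exact h

include hlam in
/-- The composed kernels never vanish on `(0, ∞)²`. -/
theorem kernel_comp_ne_zero {s : ℝ} (hs : 0 < s) (n : ℕ) {t : ℝ} (ht : 0 < t) :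
    ((greenSolI (fun t => sph lam (hyp t)) (sphDecay lam))^[n] (fun r => sphGreenKernel lam r s)) t ≠ 0 := by
  intro h0
  have h := kernel_comp_sign_pos hlam hs n ht
  rw [h0, mul_zero] at h
  exact lt_irrefl _ h

end measure

end Summit.Ventures.HodgeRepro2.T5SU11KernelCompositionStrictSign
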